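import Summits.QuantumFields.BalabanUV.Beta.GAN24.ResolventLegCharges

/-!
# `BalabanUV.Beta.GAN24.ExchangeSlotFubini` — binder row G-an2-4 ∕ (CONV-C), W-slot CT-W, conservation law (C)∕(C)sym, the OUTER FUBINI of this lineage's note
# `HOME/b2b-balaban-gan24-formalise-leaf-04/g65/CSYM-LEVEL0-KERNEL-BLUEPRINT.md` §4 (E0)→(E2): **RESUMMING ONE BACKGROUND SLOT OF AN EXCHANGE WORD — the four-leg family
# `(u′, ((y,w), y₂)) ↦ ρ₁ y·ρ₂ w·A y y₂·Q u′ y₂ w` of a bi-localised left factor `A` (a localised vertex composed with a spread kernel) and a family `Q u′` of vertices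
# bi-localised at the coarse points `N•u′` is absolutely summable, and `Σ_{u′} Σ'_{(y,w)} ρ₁ρ₂ Σ'_{y₂} A·Q u′ = Σ'_{(y,y₂)} ρ₁ A·Σ'_{(u′,w)} ρ₂ Q u′`**
# (generic `d`, blocking `N ≥ 1`; scalar entries — apply fibre entry by fibre entry)

NOT IN PRINT; OUR BOOKKEEPING ([folklore] Fubini over an absolutely convergent four-fold lattice family; majorant
`CA·CQ·e^{−(δ/2)|N u′ − q|}·e^{−δ|y − p|}·e^{−δ|w − N u′|}·e^{−(δ/2)|y₂ − q|}` by the triangle inequality `|y₂ − q| + |y₂ − N u′| ≥ |N u′ − q|`; leaf-06's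
`ResolventLegCharges.tsum_exp_coarse_le` ∕ `KernelLegCharges.summable_exp_coarse` and an2's `ExpKernelCalculus.summable_exp_shift' ∕ tsum_exp_shift' ∕ l1_sub_triangle` BY NAME;
G-an2-4 formalisation swarm, leaf prover `b2b-balaban-gan24-formalise-leaf-04`, gen 65).  HONEST FRAMING (cell contract, verbatim): «discharging `BetaPertH` makes Bałaban's UV
stability UNCONDITIONAL — a real constructive-QFT result; it is NOT the continuum limit and NOT the Clay problem.»  HONEST DEPENDENCY (verbatim): «continuum YM on T⁴ ⇐
BetaPertH ∧ nine spine estimates (0/9 proved); BetaPertH ⇐ (D1) ∧ (D4) ∧ CAP+tail; G-an2-4 gates asym, D1 and NE2/3/4.»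

WHY (blueprint §4): the two-face read-out `DressedStepFaceCharges.hasSum_mmRead_K3OfK_dressedStep` of the dressed one-step source gives, per pair of background bonds
`(b, b′) = ((μ,u),(ν,u′))`, the channel `FF[(dM_b ∘ X̃♮) ∘ dM_{b′}] = Σ'_{(y,w)} 𝟙f(y_α)𝟙f(w_β)·Σ'_{y₂} Σ_{f₂} (dM_b∘X̃♮)(y,y₂)(inl α,f₂)·dM_{b′}(y₂,w)(f₂,inl β)`; the zero mode
then sums `u′` over the lattice.  With `A y y₂ := (dM_b∘X̃♮)(y,y₂)(inl α,f₂)` (bi-localised: an5's `Loc.comp_spr`) and `Q u′ y₂ w := dM_{(ν,u′)}(y₂,w)(f₂,inl β)` (a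
`VertexFamily`: an2's `OneStepKernelFamily.vertexFamily_vertexOfK'` ∕ `SecondOrderResponse.vertexFamily_dM`), THIS FILE moves `Σ_{u′}` inside onto the right half-vertex,
where `DressedHalfVertex` ∕ `DressedWilsonHalfVertex` evaluate it as the block-periodic edge current fed to `DressedKernelOnCurrent`.

WHAT ([folklore]; 0 `def`, 0 cited facts, 0 `def … : Prop`, 0 sorry): `exp_pair_le`, **`summable_slot_family`**, **`hasSum_slot_resum`**.  Asserts NO value of Bałaban's tables;
discharges NOTHING of (C)sym ∕ (Q-D) ∕ (Q-D-rate) ∕ «T2Shape» ∕ «T2Drift» ∕ (hW, hWall); NEVER «G-an2-4 closed» as (CONV-C); NOT D1, NOT `BetaPertH`, NOT continuum, NOT Clay.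
2026-08-22; no existing file touched.
-/

noncomputable section

open Finset
open scoped BigOperators
open Literature.MathematicalPhysics.QuantumFieldTheory
open Literature.MathematicalPhysics.QuantumFieldTheory.Balaban1983to89
open Literature.MathematicalPhysics.QuantumFieldTheory.Balaban1983to89.Beta
open B12Sec2to5 (l1 l1_nonneg)
open ExpKernelCalculus (Site Zl Zl_nonneg summable_exp_shift summable_exp_shift' tsum_exp_shift tsum_exp_shift' l1_sub_triangle l1_sub_symm)
open Summit.QuantumFields.BalabanUV.Beta.GAN24.KernelLegCharges (summable_exp_coarse)
open Summit.QuantumFields.BalabanUV.Beta.GAN24.ResolventLegCharges (tsum_exp_coarse_le)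

namespace Summit.QuantumFields.BalabanUV.Beta.GAN24.ExchangeSlotFubini

variable {d : ℕ} {N : ℕ} [NeZero N]

/-- [folklore] The exponential bookkeeping: `e^{−δ|y₂−q|}·e^{−δ|y₂−N u′|} ≤ e^{−(δ/2)|y₂−q|}·e^{−(δ/2)|N u′−q|}` (`δ ≥ 0`; triangle inequality). -/
theorem exp_pair_le {δ : ℝ} (hδ : 0 ≤ δ) (y₂ q c : Site (d + 1)) :
    Real.exp (-δ * l1 (y₂ - q)) * Real.exp (-δ * l1 (y₂ - c)) ≤ Real.exp (-(δ / 2) * l1 (y₂ - q)) * Real.exp (-(δ / 2) * l1 (c - q)) := by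
  rw [← Real.exp_add, ← Real.exp_add, Real.exp_le_exp]
  have h1 := l1_sub_triangle c y₂ q
  rw [l1_sub_symm c y₂] at h1
  nlinarith [l1_nonneg (y₂ - q), l1_nonneg (y₂ - c), l1_nonneg (c - q)]

/-- [folklore] **THE FOUR-LEG FAMILY OF ONE RESUMMED EXCHANGE SLOT IS ABSOLUTELY SUMMABLE.**  Data: a left factor `A y y₂` bi-localised at `(p, q)` (the composition of a
localised vertex with a spread kernel, read on one outer leg and one fibre entry), a family `Q u′` of vertices bi-localised at the coarse points `(N•u′, N•u′)` (the chain-rule vertex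
sourced by the background bond `u′`), bounded outer weights `ρ₁ ρ₂` (exit-face indicators).  Then `(u′, ((y, w), y₂)) ↦ ρ₁ y·ρ₂ w·A y y₂·Q u′ y₂ w` is summable on
`Site × ((Site × Site) × Site)` (majorant `CA·CQ·e^{−(δ/2)|N u′ − q|}·e^{−δ|y − p|}·e^{−δ|w − N u′|}·e^{−(δ/2)|y₂ − q|}`). -/
theorem summable_slot_family {A : Site (d + 1) → Site (d + 1) → ℝ} {Q : Site (d + 1) → Site (d + 1) → Site (d + 1) → ℝ} {CA CQ δ : ℝ}
    {p q : Site (d + 1)} (hδ : 0 < δ) (hA : ∀ y y₂, |A y y₂| ≤ CA * Real.exp (-δ * (l1 (y - p) + l1 (y₂ - q))))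
    (hQ : ∀ u' y₂ w, |Q u' y₂ w| ≤ CQ * Real.exp (-δ * (l1 (y₂ - (N : ℤ) • u') + l1 (w - (N : ℤ) • u'))))
    (hCA : 0 ≤ CA) (hCQ : 0 ≤ CQ) {ρ₁ ρ₂ : Site (d + 1) → ℝ} (h₁ : ∀ y, |ρ₁ y| ≤ 1) (h₂ : ∀ w, |ρ₂ w| ≤ 1) :
    Summable fun s : Site (d + 1) × ((Site (d + 1) × Site (d + 1)) × Site (d + 1)) =>
      ρ₁ s.2.1.1 * ρ₂ s.2.1.2 * (A s.2.1.1 s.2.2 * Q s.1 s.2.2 s.2.1.2) := by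
  have hN : 1 ≤ N := Nat.one_le_iff_ne_zero.2 (NeZero.ne N)
  -- the product majorant
  set M : Site (d + 1) × ((Site (d + 1) × Site (d + 1)) × Site (d + 1)) → ℝ := fun s =>
    (CA * CQ) * ((Real.exp (-(δ / 2) * l1 ((N : ℤ) • s.1 - q))) *
      ((Real.exp (-δ * l1 (s.2.1.1 - p)) * Real.exp (-δ * l1 (s.2.1.2 - (N : ℤ) • s.1))) * Real.exp (-(δ / 2) * l1 (s.2.2 - q)))) with hM
  have hM0 : ∀ s, 0 ≤ M s := fun s => by positivity
  -- pointwise domination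
  have hle : ∀ s, |ρ₁ s.2.1.1 * ρ₂ s.2.1.2 * (A s.2.1.1 s.2.2 * Q s.1 s.2.2 s.2.1.2)| ≤ M s := by
    rintro ⟨u', ⟨y, w⟩, y₂⟩
    simp only [hM]
    have hterm : |A y y₂ * Q u' y₂ w| ≤ (CA * CQ) * ((Real.exp (-(δ / 2) * l1 ((N : ℤ) • u' - q))) *
        ((Real.exp (-δ * l1 (y - p)) * Real.exp (-δ * l1 (w - (N : ℤ) • u'))) * Real.exp (-(δ / 2) * l1 (y₂ - q)))) := by
      rw [abs_mul]
      have e1 := hA y y₂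
      have e2 := hQ u' y₂ w
      rw [mul_add, Real.exp_add] at e1 e2
      have e3 := exp_pair_le (d := d) hδ.le y₂ q ((N : ℤ) • u')
      calc |A y y₂| * |Q u' y₂ w|
          ≤ (CA * (Real.exp (-δ * l1 (y - p)) * Real.exp (-δ * l1 (y₂ - q)))) *
              (CQ * (Real.exp (-δ * l1 (y₂ - (N : ℤ) • u')) * Real.exp (-δ * l1 (w - (N : ℤ) • u')))) :=
            mul_le_mul e1 e2 (abs_nonneg _) ((abs_nonneg _).trans e1)
        _ = (CA * CQ) * (Real.exp (-δ * l1 (y - p)) * Real.exp (-δ * l1 (w - (N : ℤ) • u'))) *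
              (Real.exp (-δ * l1 (y₂ - q)) * Real.exp (-δ * l1 (y₂ - (N : ℤ) • u'))) := by ring
        _ ≤ (CA * CQ) * (Real.exp (-δ * l1 (y - p)) * Real.exp (-δ * l1 (w - (N : ℤ) • u'))) *
              (Real.exp (-(δ / 2) * l1 (y₂ - q)) * Real.exp (-(δ / 2) * l1 ((N : ℤ) • u' - q))) :=
            mul_le_mul_of_nonneg_left e3 (by positivity)
        _ = _ := by ring
    have hρ : |ρ₁ y * ρ₂ w| ≤ 1 := by
      rw [abs_mul]
      have := mul_le_mul (h₁ y) (h₂ w) (abs_nonneg _) zero_le_one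
      simpa using this
    rw [abs_mul]
    calc |ρ₁ y * ρ₂ w| * |A y y₂ * Q u' y₂ w| ≤ 1 * ((CA * CQ) * ((Real.exp (-(δ / 2) * l1 ((N : ℤ) • u' - q))) *
        ((Real.exp (-δ * l1 (y - p)) * Real.exp (-δ * l1 (w - (N : ℤ) • u'))) * Real.exp (-(δ / 2) * l1 (y₂ - q))))) :=
          mul_le_mul hρ hterm (abs_nonneg _) zero_le_one
      _ = _ := by ring
  -- summability of the majorant: fibres over `u′`, then the coarse sum
  have hδ2 : 0 < δ / 2 := half_pos hδ
  have hin : ∀ u' : Site (d + 1), HasSum (fun x : (Site (d + 1) × Site (d + 1)) × Site (d + 1) =>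
      (Real.exp (-δ * l1 (x.1.1 - p)) * Real.exp (-δ * l1 (x.1.2 - (N : ℤ) • u'))) * Real.exp (-(δ / 2) * l1 (x.2 - q)))
      ((Zl (d + 1) δ * Zl (d + 1) δ) * Zl (d + 1) (δ / 2)) := by
    intro u'
    have hy := summable_exp_shift' hδ p
    have hw := summable_exp_shift' hδ ((N : ℤ) • u')
    have hy2 := summable_exp_shift' hδ2 q
    have hyw : HasSum (fun yw : Site (d + 1) × Site (d + 1) => Real.exp (-δ * l1 (yw.1 - p)) * Real.exp (-δ * l1 (yw.2 - (N : ℤ) • u')))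
        (Zl (d + 1) δ * Zl (d + 1) δ) := by
      have h := hy.hasSum.mul hw.hasSum (hy.mul_of_nonneg hw (fun _ => (Real.exp_pos _).le) (fun _ => (Real.exp_pos _).le))
      rw [tsum_exp_shift', tsum_exp_shift'] at h
      exact h
    have h := hyw.mul hy2.hasSum (hyw.summable.mul_of_nonneg hy2 (fun _ => by positivity) (fun _ => (Real.exp_pos _).le))
    rw [tsum_exp_shift'] at h
    exact h
  have hMs : Summable M := by
    refine (summable_prod_of_nonneg hM0).2 ⟨fun u' => (((hin u').summable.mul_left (Real.exp (-(δ / 2) * l1 ((N : ℤ) • u' - q)))).mul_left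
      (CA * CQ)).congr fun x => by simp only [hM], ?_⟩
    have e : (fun u' : Site (d + 1) => ∑' x, M (u', x)) = fun u' => (CA * CQ) * ((Zl (d + 1) δ * Zl (d + 1) δ) * Zl (d + 1) (δ / 2)) *
        Real.exp (-(δ / 2) * l1 ((N : ℤ) • u' - q)) := by
      funext u'
      simp only [hM]
      rw [tsum_mul_left, tsum_mul_left, (hin u').tsum_eq]
      ring
    rw [e]
    exact (summable_exp_coarse (d := d) hN hδ2 q).mul_left _
  exact Summable.of_norm_bounded hMs (fun s => by rw [Real.norm_eq_abs]; exact hle s)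

/-- [folklore] **RESUMMING ONE BACKGROUND SLOT OF AN EXCHANGE WORD** (the outer Fubini of note `g65/CSYM-LEVEL0-KERNEL-BLUEPRINT.md` §4 (E0)→(E2)): with the data of
`summable_slot_family`, the family `u′ ↦ Σ'_{(y,w)} ρ₁ y·ρ₂ w·Σ'_{y₂} A y y₂·Q u′ y₂ w` (the two-face read-out of the word `(left ∘ X) ∘ Q_{u′}` at one fibre entry) has the
`HasSum` `Σ'_{(y,y₂)} ρ₁ y·A y y₂·Σ'_{(u′,w)} ρ₂ w·Q u′ y₂ w` — the background bond is resummed INSIDE, against the right half-vertex alone. -/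
theorem hasSum_slot_resum {A : Site (d + 1) → Site (d + 1) → ℝ} {Q : Site (d + 1) → Site (d + 1) → Site (d + 1) → ℝ} {CA CQ δ : ℝ}
    {p q : Site (d + 1)} (hδ : 0 < δ) (hA : ∀ y y₂, |A y y₂| ≤ CA * Real.exp (-δ * (l1 (y - p) + l1 (y₂ - q))))
    (hQ : ∀ u' y₂ w, |Q u' y₂ w| ≤ CQ * Real.exp (-δ * (l1 (y₂ - (N : ℤ) • u') + l1 (w - (N : ℤ) • u'))))
    (hCA : 0 ≤ CA) (hCQ : 0 ≤ CQ) {ρ₁ ρ₂ : Site (d + 1) → ℝ} (h₁ : ∀ y, |ρ₁ y| ≤ 1) (h₂ : ∀ w, |ρ₂ w| ≤ 1) :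
    HasSum (fun u' : Site (d + 1) => ∑' yw : Site (d + 1) × Site (d + 1), ρ₁ yw.1 * ρ₂ yw.2 * ∑' y₂ : Site (d + 1), A yw.1 y₂ * Q u' y₂ yw.2)
      (∑' yy : Site (d + 1) × Site (d + 1), ρ₁ yy.1 * A yy.1 yy.2 * ∑' uw : Site (d + 1) × Site (d + 1), ρ₂ uw.2 * Q uw.1 yy.2 uw.2) := by
  set Φ : Site (d + 1) × ((Site (d + 1) × Site (d + 1)) × Site (d + 1)) → ℝ := fun s =>
    ρ₁ s.2.1.1 * ρ₂ s.2.1.2 * (A s.2.1.1 s.2.2 * Q s.1 s.2.2 s.2.1.2) with hΦ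
  have hΦs : Summable Φ := summable_slot_family (N := N) hδ hA hQ hCA hCQ h₁ h₂
  -- the `u′`-fibres are the nested inner sums
  have hfib : ∀ u', ∑' x : (Site (d + 1) × Site (d + 1)) × Site (d + 1), Φ (u', x) =
      ∑' yw : Site (d + 1) × Site (d + 1), ρ₁ yw.1 * ρ₂ yw.2 * ∑' y₂ : Site (d + 1), A yw.1 y₂ * Q u' y₂ yw.2 := by
    intro u'
    rw [(hΦs.prod_factor u').tsum_prod]
    refine tsum_congr fun yw => ?_
    simp only [hΦ]
    rw [← tsum_mul_left]
  have h1 : HasSum (fun u' => ∑' x : (Site (d + 1) × Site (d + 1)) × Site (d + 1), Φ (u', x)) (∑' s, Φ s) := by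
    rw [hΦs.tsum_prod]
    exact hΦs.prod.hasSum
  simp_rw [hfib] at h1
  convert h1 using 1
  -- regroup the total: `(u′, ((y,w), y₂)) ↔ ((y, y₂), (u′, w))`
  let e : (Site (d + 1) × Site (d + 1)) × (Site (d + 1) × Site (d + 1)) ≃ Site (d + 1) × ((Site (d + 1) × Site (d + 1)) × Site (d + 1)) :=
    { toFun := fun t => (t.2.1, ((t.1.1, t.2.2), t.1.2))
      invFun := fun s => ((s.2.1.1, s.2.2), (s.1, s.2.1.2))
      left_inv := fun t => rfl
      right_inv := fun s => rfl }
  have hΨ : Summable (fun t => Φ (e t)) := (e.summable_iff (f := Φ)).2 hΦs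
  rw [← e.tsum_eq Φ, hΨ.tsum_prod]
  refine tsum_congr fun yy => ?_
  have hfy : Summable fun uw : Site (d + 1) × Site (d + 1) => Φ (e (yy, uw)) := hΨ.prod_factor yy
  simp only [hΦ, e, Equiv.coe_fn_mk] at hfy ⊢
  rw [← tsum_mul_left]
  exact tsum_congr fun uw => by ring

end Summit.QuantumFields.BalabanUV.Beta.GAN24.ExchangeSlotFubini

end
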